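import Mathlib.RingTheory.PowerSeries.Derivative
import Mathlib.RingTheory.PowerSeries.Order
import Mathlib.Algebra.Polynomial.Derivative
import Mathlib.Algebra.Polynomial.Degree.Lemmas
import Mathlib.Tactic
import HarnessLib

/-!
# Shidlovsky's lemma, I: the derived linear forms

Setting of Shidlovsky's lemma (A. B. Shidlovskii 1959; K. Mahler, *Lectures on transcendental
numbers*, LNM 546, Ch. 3 §§46, 53, 57 [Mahler1976]; quoted by Calegari–Dimitrov–Tang
[CalegariDimitrovTang2024, §3.2 Theorem 37]). A system of `m` homogeneous linear differential
equations with rational coefficients is written with cleared denominators as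
`κ · w_h′ = Σ_k B_{h k} w_k` (`κ ∈ K[X] ∖ 0`, `B ∈ M_m(K[X])`, Mahler's `κ q`). For a linear
form `λ(w) = Σ_k p_k w_k` with polynomial coefficients Mahler's operator `D` (§46, §53 eq. (7))
is `(D p)_k = κ p_k′ + Σ_h p_h B_{h k}`; its iterates are the **derived forms**
`λ_1 = λ, λ_{h+1} = D λ_h`. This file records the two formal properties used in the lemma:

* `derivOp`, `derivedForm`; `natDegree_derivedForm_le` — §57 eq. (15): the coefficients of
  `λ_{h+1}` are polynomials of degree `≤ X + h·C₂`, `X = max deg p_k`,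
  `C₂ = max{deg κ, deg B_{hk}}` (`degBound`).
* `evalForm`, `IsSol`; `evalForm_derivOp` — §46: for every solution `w` of the system,
  `(D λ)(w) = κ · (λ(w))′`. This is stated relative to any ring homomorphism
  `σ : K[X] →+* K⟦X⟧` commuting with the derivative (`σ = ` the inclusion, i.e. expansion at
  `0`, or the expansion `p ↦ p(c + t)` at another point `c`), so that it serves both at the point
  where the given solution lives and at an auxiliary regular point.
* `order_evalForm_le` — consequently `ord λ_{h+1}(f) ≥ ord λ(f) − h` (§58 eq. (20)), at the
  inclusion `σ`.
* `order_evalForm_le_of_det_ne_zero` — **the full-rank case of Shidlovsky's lemma** (Mahler's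
  remark after Theorem 7, p. 72): if the determinant of the first `m` derived forms is non-zero,
  then for every solution `f` at the point `0` (possibly a singular point of the system) with
  `f_{k₀} ≠ 0`, `λ(f) ≠ 0` and `ord λ(f) ≤ m·X + C₂·m(m−1)/2 + (m−1) + ord f_{k₀}` (Cramer's
  rule with the adjugate, `natDegree_det_derivedMatrix_le` = §57 eq. (16)). The complementary
  rank-deficient case (Shidlovsky's Theorem 6 in Mahler's numbering) is the subject of the sequel.

## References
* [Mahler1976] K. Mahler, *Lectures on transcendental numbers*, LNM 546, Springer 1976,
  Ch. 3 §§46, 53, 57–58 and p. 72.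
* [CalegariDimitrovTang2024] F. Calegari, V. Dimitrov, Y. Tang, arXiv:2408.15403, §3.2 Thm 37.
-/

namespace Literature.NumberTheory.Transcendental

namespace Shidlovsky

open Polynomial Finset
open scoped PowerSeries

noncomputable section

variable {K : Type*} [Field K] {m : ℕ}

/-! ### The operator `D` and the derived forms -/

/-- Mahler's operator `D` on coefficient vectors of linear forms:
`(D p)_k = κ p_k′ + Σ_h p_h B_{h k}`. [cite: Mahler1976, Ch. 3 §46; §53 eq. (7)] -/
def derivOp (κ : K[X]) (B : Matrix (Fin m) (Fin m) K[X]) (p : Fin m → K[X]) : Fin m → K[X] :=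
  fun k => κ * Polynomial.derivative (p k) + ∑ h, p h * B h k

/-- The coefficient vector of the `h`-th derived form `λ_{h+1} = D^h λ` (we index from `0`).
[cite: Mahler1976, Ch. 3 §53 eq. (7)] -/
def derivedForm (κ : K[X]) (B : Matrix (Fin m) (Fin m) K[X]) (p : Fin m → K[X]) (h : ℕ) :
    Fin m → K[X] :=
  (derivOp κ B)^[h] p

/-- `λ_1 = λ`. [cite: Mahler1976, Ch. 3 §53 eq. (7)] -/
theorem derivedForm_zero (κ : K[X]) (B : Matrix (Fin m) (Fin m) K[X]) (p : Fin m → K[X]) :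
    derivedForm κ B p 0 = p := rfl

/-- `λ_{h+2} = D λ_{h+1}`. [cite: Mahler1976, Ch. 3 §53 eq. (7)] -/
theorem derivedForm_succ (κ : K[X]) (B : Matrix (Fin m) (Fin m) K[X]) (p : Fin m → K[X]) (h : ℕ) :
    derivedForm κ B p (h + 1) = derivOp κ B (derivedForm κ B p h) := by
  rw [derivedForm, derivedForm, Function.iterate_succ_apply']

/-- `D` is additive. [folklore] -/
theorem derivOp_add (κ : K[X]) (B : Matrix (Fin m) (Fin m) K[X]) (p q : Fin m → K[X]) :
    derivOp κ B (p + q) = derivOp κ B p + derivOp κ B q := by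
  funext k
  simp only [derivOp, Pi.add_apply, map_add, add_mul, Finset.sum_add_distrib]
  ring

/-- `D (a p) = κ a′ p + a D p` for a polynomial `a`. [cite: Mahler1976, Ch. 3 §46] -/
theorem derivOp_smul (κ : K[X]) (B : Matrix (Fin m) (Fin m) K[X]) (a : K[X]) (p : Fin m → K[X]) :
    derivOp κ B (a • p) = (κ * Polynomial.derivative a) • p + a • derivOp κ B p := by
  funext k
  simp only [derivOp, Pi.add_apply, Pi.smul_apply, smul_eq_mul, derivative_mul]
  have h1 : ∑ h, a * p h * B h k = a * ∑ h, p h * B h k := by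
    rw [Finset.mul_sum]
    exact Finset.sum_congr rfl fun h _ => mul_assoc _ _ _
  rw [h1]; ring

/-! ### Degrees (§57 eq. (15)) -/

/-- `C₂ = max{deg κ, deg B_{hk}}`. [cite: Mahler1976, Ch. 3 §57] -/
def degBound (κ : K[X]) (B : Matrix (Fin m) (Fin m) K[X]) : ℕ :=
  max κ.natDegree (Finset.univ.sup fun hk : Fin m × Fin m => (B hk.1 hk.2).natDegree)

/-- `deg B_{hk} ≤ C₂`. [folklore] -/
theorem natDegree_le_degBound (κ : K[X]) (B : Matrix (Fin m) (Fin m) K[X]) (h k : Fin m) :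
    (B h k).natDegree ≤ degBound κ B :=
  le_max_of_le_right (Finset.le_sup (f := fun hk : Fin m × Fin m => (B hk.1 hk.2).natDegree)
    (Finset.mem_univ (h, k)))

/-- `deg κ ≤ C₂`. [folklore] -/
theorem natDegree_kappa_le_degBound (κ : K[X]) (B : Matrix (Fin m) (Fin m) K[X]) :
    κ.natDegree ≤ degBound κ B := le_max_left _ _

/-- One application of `D` raises degrees by at most `C₂`. [cite: Mahler1976, Ch. 3 §57 eq. (15)] -/
theorem natDegree_derivOp_le (κ : K[X]) (B : Matrix (Fin m) (Fin m) K[X]) {p : Fin m → K[X]} {N : ℕ}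
    (hp : ∀ k, (p k).natDegree ≤ N) (k : Fin m) : (derivOp κ B p k).natDegree ≤ N + degBound κ B := by
  unfold derivOp
  refine (natDegree_add_le _ _).trans (max_le ?_ ?_)
  · refine natDegree_mul_le.trans ?_
    have h1 := natDegree_kappa_le_degBound κ B
    have h2 : (Polynomial.derivative (p k)).natDegree ≤ N :=
      (natDegree_derivative_le _).trans ((Nat.sub_le _ _).trans (hp k))
    omega
  · refine (natDegree_sum_le _ _).trans ?_
    rw [Finset.fold_max_le]
    refine ⟨by simp, fun h _ => ?_⟩
    refine natDegree_mul_le.trans ?_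
    have := natDegree_le_degBound κ B h k
    have := hp h
    omega

/-- **The derived forms have degrees `≤ X + h·C₂`.** [cite: Mahler1976, Ch. 3 §57 eq. (15)] -/
theorem natDegree_derivedForm_le (κ : K[X]) (B : Matrix (Fin m) (Fin m) K[X]) {p : Fin m → K[X]}
    {N : ℕ} (hp : ∀ k, (p k).natDegree ≤ N) (h : ℕ) (k : Fin m) :
    (derivedForm κ B p h k).natDegree ≤ N + h * degBound κ B := by
  induction h generalizing k with
  | zero => simpa [derivedForm_zero] using hp k
  | succ h ih =>
    rw [derivedForm_succ]
    have := natDegree_derivOp_le κ B ih k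
    rw [Nat.succ_mul]; omega

/-! ### Evaluation on solutions (§46) -/

variable (σ : K[X] →+* K⟦X⟧)

/-- The value `λ(w) = Σ_k p_k w_k` of a form on a vector of power series, the polynomial
coefficients being expanded through `σ`. [cite: Mahler1976, Ch. 3 §46] -/
def evalForm (p : Fin m → K[X]) (w : Fin m → K⟦X⟧) : K⟦X⟧ := ∑ k, σ (p k) * w k

/-- `w` solves `κ w_h′ = Σ_k B_{hk} w_k` (coefficients expanded through `σ`).
[cite: Mahler1976, Ch. 3 §44] -/
def IsSol (κ : K[X]) (B : Matrix (Fin m) (Fin m) K[X]) (w : Fin m → K⟦X⟧) : Prop :=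
  ∀ h, σ κ * PowerSeries.derivative K (w h) = ∑ k, σ (B h k) * w k

/-- `λ + λ'` evaluates additively. [folklore] -/
theorem evalForm_add (p q : Fin m → K[X]) (w : Fin m → K⟦X⟧) :
    evalForm σ (p + q) w = evalForm σ p w + evalForm σ q w := by
  simp only [evalForm, Pi.add_apply, map_add, add_mul, Finset.sum_add_distrib]

/-- `(a λ)(w) = a · λ(w)`. [folklore] -/
theorem evalForm_smul (a : K[X]) (p : Fin m → K[X]) (w : Fin m → K⟦X⟧) :
    evalForm σ (a • p) w = σ a * evalForm σ p w := by
  simp only [evalForm, Pi.smul_apply, smul_eq_mul, map_mul, Finset.mul_sum, mul_assoc]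

/-- Finite sums of forms evaluate termwise. [folklore] -/
theorem evalForm_sum {ι : Type*} (s : Finset ι) (p : ι → Fin m → K[X]) (w : Fin m → K⟦X⟧) :
    evalForm σ (∑ i ∈ s, p i) w = ∑ i ∈ s, evalForm σ (p i) w := by
  classical
  induction s using Finset.induction_on with
  | empty => simp [evalForm]
  | insert a s ha ih => rw [Finset.sum_insert ha, Finset.sum_insert ha, evalForm_add, ih]

/-- **`(D λ)(w) = κ · (λ(w))′` for every solution `w`.** [cite: Mahler1976, Ch. 3 §46] -/
theorem evalForm_derivOp {κ : K[X]} {B : Matrix (Fin m) (Fin m) K[X]}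
    (hσ : ∀ p : K[X], PowerSeries.derivative K (σ p) = σ (Polynomial.derivative p))
    (p : Fin m → K[X]) {w : Fin m → K⟦X⟧} (hw : IsSol σ κ B w) :
    evalForm σ (derivOp κ B p) w = σ κ * PowerSeries.derivative K (evalForm σ p w) := by
  unfold evalForm derivOp
  have hL : ∑ k, σ (κ * Polynomial.derivative (p k) + ∑ h, p h * B h k) * w k =
      ∑ k, σ κ * σ (Polynomial.derivative (p k)) * w k + ∑ k, ∑ h, σ (p h) * σ (B h k) * w k := by
    rw [← Finset.sum_add_distrib]
    refine Finset.sum_congr rfl fun k _ => ?_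
    simp only [map_add, map_mul, map_sum, add_mul, Finset.sum_mul]
  have hR : σ κ * PowerSeries.derivative K (∑ k, σ (p k) * w k) =
      ∑ k, σ κ * σ (Polynomial.derivative (p k)) * w k + ∑ k, σ (p k) * ∑ j, σ (B k j) * w j := by
    rw [map_sum, Finset.mul_sum, ← Finset.sum_add_distrib]
    refine Finset.sum_congr rfl fun k _ => ?_
    rw [Derivation.leibniz, smul_eq_mul, smul_eq_mul, hσ]
    linear_combination (σ (p k)) * hw k
  rw [hL, hR, add_right_inj, Finset.sum_comm]
  refine Finset.sum_congr rfl fun k _ => ?_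
  rw [Finset.mul_sum]
  exact Finset.sum_congr rfl fun j _ => by ring

/-- Iterated: `λ_{h+2}(w) = κ (λ_{h+1}(w))′`. [cite: Mahler1976, Ch. 3 §53] -/
theorem evalForm_derivedForm_succ {κ : K[X]} {B : Matrix (Fin m) (Fin m) K[X]}
    (hσ : ∀ p : K[X], PowerSeries.derivative K (σ p) = σ (Polynomial.derivative p))
    (p : Fin m → K[X]) {w : Fin m → K⟦X⟧} (hw : IsSol σ κ B w) (h : ℕ) :
    evalForm σ (derivedForm κ B p (h + 1)) w =
      σ κ * PowerSeries.derivative K (evalForm σ (derivedForm κ B p h) w) := by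
  rw [derivedForm_succ, evalForm_derivOp σ hσ _ hw]

/-! ### At the inclusion `K[X] ⊆ K⟦X⟧`: orders of the derived values (§58 eq. (20)) -/

/-- The inclusion of polynomials into power series, as a ring homomorphism. [folklore] -/
def incl : K[X] →+* K⟦X⟧ := Polynomial.coeToPowerSeries.ringHom

/-- `incl p = ↑p`. [folklore] -/
@[simp] theorem incl_apply (p : K[X]) : (incl : K[X] →+* K⟦X⟧) p = (p : K⟦X⟧) := rfl

/-- The inclusion commutes with the derivative. [folklore] -/
theorem derivative_incl (p : K[X]) :
    PowerSeries.derivative K ((incl : K[X] →+* K⟦X⟧) p) = incl (Polynomial.derivative p) := by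
  rw [incl_apply, incl_apply, PowerSeries.derivative_coe]

/-- `ord g ≤ ord g′ + 1`. [folklore] -/
theorem order_le_order_derivative_add_one (g : K⟦X⟧) :
    g.order ≤ (PowerSeries.derivative K g).order + 1 := by
  by_cases hdg : PowerSeries.derivative K g = 0
  · rw [hdg, PowerSeries.order_zero]; exact le_top
  · have h := PowerSeries.coeff_order hdg
    rw [PowerSeries.coeff_derivative] at h
    have h' : PowerSeries.coeff ((PowerSeries.derivative K g).order.toNat + 1) g ≠ 0 :=
      fun h0 => h (by rw [h0, zero_mul])
    have := PowerSeries.order_le _ h'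
    calc g.order ≤ ((PowerSeries.derivative K g).order.toNat + 1 : ℕ) := this
      _ = (PowerSeries.derivative K g).order + 1 := by
          push_cast
          rw [PowerSeries.coe_toNat_order hdg]

/-- `ord g ≤ ord (a g′) + 1`. [folklore] -/
theorem order_le_order_mul_derivative_add_one (a g : K⟦X⟧) :
    g.order ≤ (a * PowerSeries.derivative K g).order + 1 := by
  refine (order_le_order_derivative_add_one g).trans (add_le_add ?_ le_rfl)
  exact le_trans (le_add_self) (PowerSeries.order_mul_ge a _)

/-- **`ord λ(f) ≤ ord λ_{h+1}(f) + h`** (Mahler §58 eq. (20): `ord λ_{h+1}(f) ≥ ord λ_1(f) − h`)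
for a solution `f ∈ K⟦X⟧ᵐ` of the system at the point `0`.
[cite: Mahler1976, Ch. 3 §58 eq. (20)] -/
theorem order_evalForm_le (κ : K[X]) (B : Matrix (Fin m) (Fin m) K[X]) (p : Fin m → K[X])
    {f : Fin m → K⟦X⟧} (hf : IsSol incl κ B f) (h : ℕ) :
    (evalForm incl p f).order ≤ (evalForm incl (derivedForm κ B p h) f).order + h := by
  induction h with
  | zero => simp [derivedForm_zero]
  | succ h ih =>
    have hstep := order_le_order_mul_derivative_add_one (incl κ)
      (evalForm incl (derivedForm κ B p h) f)
    rw [← evalForm_derivedForm_succ incl derivative_incl p hf h] at hstep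
    calc (evalForm incl p f).order ≤ (evalForm incl (derivedForm κ B p h) f).order + h := ih
      _ ≤ (evalForm incl (derivedForm κ B p (h + 1)) f).order + 1 + h := add_le_add hstep le_rfl
      _ = (evalForm incl (derivedForm κ B p (h + 1)) f).order + ↑(h + 1) := by
          push_cast; rw [add_assoc, add_comm (1 : ℕ∞)]

/-! ### Degree of a determinant, order of a polynomial -/

omit [Field K] in
/-- `deg det M ≤ Σ_h d_h` if row `h` of `M` has entries of degree `≤ d_h`. [folklore] -/
theorem natDegree_det_le_sum {R : Type*} [CommRing R] [Nontrivial R] (M : Matrix (Fin m) (Fin m) R[X])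
    (d : Fin m → ℕ) (hM : ∀ h k, (M h k).natDegree ≤ d h) : M.det.natDegree ≤ ∑ h, d h := by
  rw [Matrix.det_apply]
  refine natDegree_sum_le_of_forall_le _ _ fun σ _ => ?_
  refine (natDegree_smul_le _ _).trans ?_
  refine (natDegree_prod_le _ _).trans ?_
  calc ∑ i, (M (σ i) i).natDegree ≤ ∑ i, d (σ i) := Finset.sum_le_sum fun i _ => hM _ _
    _ = ∑ h, d h := Equiv.sum_comp σ d

/-- The `X`-adic order of a non-zero polynomial is at most its degree. [folklore] -/
theorem order_coe_le_natDegree {P : K[X]} (hP : P ≠ 0) : (P : K⟦X⟧).order ≤ P.natDegree := by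
  refine PowerSeries.order_le _ ?_
  rw [Polynomial.coeff_coe]
  exact Polynomial.leadingCoeff_ne_zero.mpr hP

/-- `n ≤ ord (Σ g_i)` if `n ≤ ord g_i` for all `i`. [folklore] -/
theorem le_order_sum {ι : Type*} (s : Finset ι) (g : ι → K⟦X⟧) {n : ℕ∞}
    (h : ∀ i ∈ s, n ≤ (g i).order) : n ≤ (∑ i ∈ s, g i).order := by
  classical
  induction s using Finset.induction_on with
  | empty => simp
  | insert a s ha ih =>
    rw [Finset.sum_insert ha]
    refine le_trans ?_ (PowerSeries.min_order_le_order_add _ _)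
    exact le_min (h a (Finset.mem_insert_self a s))
      (ih fun i hi => h i (Finset.mem_insert_of_mem hi))

/-! ### The full-rank case (Mahler §58, final remark p. 72) -/

/-- The `m × m` matrix of the first `m` derived forms `(λ_{h+1,k})_{h,k < m}`.
[cite: Mahler1976, Ch. 3 §53 (the determinant of Theorem 6)] -/
def derivedMatrix (κ : K[X]) (B : Matrix (Fin m) (Fin m) K[X]) (p : Fin m → K[X]) :
    Matrix (Fin m) (Fin m) K[X] :=
  Matrix.of fun h k => derivedForm κ B p h k

/-- `deg det (λ_{h,k}) ≤ mX + C₂ m(m−1)/2`. [cite: Mahler1976, Ch. 3 §57 eq. (16)] -/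
theorem natDegree_det_derivedMatrix_le (κ : K[X]) (B : Matrix (Fin m) (Fin m) K[X])
    {p : Fin m → K[X]} {N : ℕ} (hp : ∀ k, (p k).natDegree ≤ N) :
    (derivedMatrix κ B p).det.natDegree ≤ m * N + (m * (m - 1) / 2) * degBound κ B := by
  refine (natDegree_det_le_sum (derivedMatrix κ B p) (fun h => N + h * degBound κ B)
    fun h k => natDegree_derivedForm_le κ B hp h k).trans ?_
  rw [Finset.sum_add_distrib, Finset.sum_const, Finset.card_univ, Fintype.card_fin, smul_eq_mul,
    ← Finset.sum_mul, Fin.sum_univ_eq_sum_range (fun i => i) m, Finset.sum_range_id]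

/-- The values of the derived forms as a matrix–vector product. [folklore] -/
theorem evalForm_derivedForm_eq_mulVec (κ : K[X]) (B : Matrix (Fin m) (Fin m) K[X]) (p : Fin m → K[X])
    (f : Fin m → K⟦X⟧) (h : Fin m) :
    evalForm incl (derivedForm κ B p h) f = ((derivedMatrix κ B p).map incl).mulVec f h := by
  simp only [Matrix.mulVec, dotProduct, Matrix.map_apply, derivedMatrix, Matrix.of_apply, evalForm]

/-- **Shidlovsky's lemma, full-rank case** (Mahler's final remark, p. 72): if the determinant of
the first `m` derived forms does not vanish, then for a solution `f ∈ K⟦X⟧ᵐ` (at the point `0`,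
which may be singular) with `f_{k₀} ≠ 0` the value `λ(f)` is non-zero and
`ord λ(f) ≤ m·X + C₂·m(m−1)/2 + (m−1) + ord f_{k₀}`, `X = max deg p_k`.
[cite: Mahler1976, Ch. 3 §58 and the remark following Theorem 7 (p. 72)] -/
theorem order_evalForm_le_of_det_ne_zero (κ : K[X]) (B : Matrix (Fin m) (Fin m) K[X])
    {f : Fin m → K⟦X⟧} (hf : IsSol incl κ B f) {k₀ : Fin m} (hk₀ : f k₀ ≠ 0)
    (p : Fin m → K[X]) {N : ℕ} (hp : ∀ k, (p k).natDegree ≤ N)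
    (hdet : (derivedMatrix κ B p).det ≠ 0) :
    evalForm incl p f ≠ 0 ∧ (evalForm incl p f).order.toNat ≤
      m * N + (m * (m - 1) / 2) * degBound κ B + (m - 1) + (f k₀).order.toNat := by
  classical
  set R := derivedMatrix κ B p with hR
  set Rm : Matrix (Fin m) (Fin m) K⟦X⟧ := R.map incl with hRm
  set L : ℕ → K⟦X⟧ := fun h => evalForm incl (derivedForm κ B p h) f with hL
  have hLvec : ∀ h : Fin m, L h = Rm.mulVec f h := fun h => evalForm_derivedForm_eq_mulVec κ B p f h
  -- Cramer: `det Rm • f = adj Rm *ᵥ (Rm *ᵥ f)`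
  have hdetm : Rm.det = incl R.det := by
    rw [hRm, RingHom.map_det, RingHom.mapMatrix_apply]
  have hcramer : (incl R.det) * f k₀ = ∑ h : Fin m, Rm.adjugate k₀ h * L h := by
    have h1 : Rm.adjugate.mulVec (Rm.mulVec f) = Rm.det • f := by
      rw [Matrix.mulVec_mulVec, Matrix.adjugate_mul, Matrix.smul_mulVec, Matrix.one_mulVec]
    have h2 := congrFun h1 k₀
    rw [Pi.smul_apply, smul_eq_mul, hdetm] at h2
    rw [← h2, Matrix.mulVec, dotProduct]
    exact Finset.sum_congr rfl fun h _ => by rw [hLvec h]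
  have hΔ0 : (incl R.det : K⟦X⟧) ≠ 0 := by
    rw [incl_apply, Ne, Polynomial.coe_eq_zero_iff]; exact hdet
  -- `λ(f) ≠ 0`: otherwise all derived values vanish and Cramer gives `Δ f_{k₀} = 0`
  have hsucc : ∀ h : ℕ, L (h + 1) = incl κ * PowerSeries.derivative K (L h) := fun h =>
    evalForm_derivedForm_succ incl derivative_incl p hf h
  have hne : evalForm incl p f ≠ 0 := by
    intro h0
    have hall : ∀ h : ℕ, L h = 0 := by
      intro h
      induction h with
      | zero => simpa [hL, derivedForm_zero] using h0
      | succ h ih => rw [hsucc, ih, map_zero, mul_zero]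
    have : (incl R.det) * f k₀ = 0 := by
      rw [hcramer]; exact Finset.sum_eq_zero fun h _ => by rw [hall h, mul_zero]
    rcases mul_eq_zero.mp this with h | h
    · exact hΔ0 h
    · exact hk₀ h
  refine ⟨hne, ?_⟩
  -- orders
  set y := (evalForm incl p f).order.toNat with hy
  have hyeq : (evalForm incl p f).order = y := (PowerSeries.coe_toNat_order hne).symm
  have hLh : ∀ h : Fin m, ((y - (m - 1) : ℕ) : ℕ∞) ≤ (L h).order := by
    intro h
    have h1 := order_evalForm_le κ B p hf h
    rw [hyeq] at h1
    -- `y ≤ ord L_h + h`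
    by_cases htop : (L h).order = ⊤
    · rw [htop]; exact le_top
    · have h2 : (L h).order = (L h).order.toNat := (ENat.coe_toNat htop).symm
      rw [h2] at h1 ⊢
      have h3 : y ≤ (L h).order.toNat + h := by exact_mod_cast h1
      have h4 : (h : ℕ) ≤ m - 1 := by have := h.isLt; omega
      exact_mod_cast (show y - (m - 1) ≤ (L h).order.toNat by omega)
  have hsum : ((y - (m - 1) : ℕ) : ℕ∞) ≤ (∑ h : Fin m, Rm.adjugate k₀ h * L h).order :=
    le_order_sum _ _ fun h _ => (hLh h).trans (by
      rw [PowerSeries.order_mul]; exact le_add_self)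
  rw [← hcramer, PowerSeries.order_mul] at hsum
  have hordΔ : (incl R.det : K⟦X⟧).order ≤ (m * N + (m * (m - 1) / 2) * degBound κ B : ℕ) :=
    (order_coe_le_natDegree hdet).trans (by exact_mod_cast natDegree_det_derivedMatrix_le κ B hp)
  have hΔnat : (incl R.det : K⟦X⟧).order = (incl R.det : K⟦X⟧).order.toNat :=
    (PowerSeries.coe_toNat_order hΔ0).symm
  have hfnat : (f k₀).order = (f k₀).order.toNat := (PowerSeries.coe_toNat_order hk₀).symm
  rw [hΔnat, hfnat] at hsum
  rw [hΔnat] at hordΔ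
  have h5 : y - (m - 1) ≤ (incl R.det : K⟦X⟧).order.toNat + (f k₀).order.toNat := by exact_mod_cast hsum
  have h6 : (incl R.det : K⟦X⟧).order.toNat ≤ m * N + (m * (m - 1) / 2) * degBound κ B := by
    exact_mod_cast hordΔ
  omega

end

end Shidlovsky

end Literature.NumberTheory.Transcendental
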